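import Literature.AnabelianGeometry.EtaleTheta.SettingModelTateMuTwoCLevel
import Literature.AnabelianGeometry.EtaleTheta.SettingModelTateOrigin
import Literature.AnabelianGeometry.EtaleTheta.MuTwoSettingPiCData
import HarnessLib

/-!
# The STAGE-2 («Tate shear») model of [EtTh] §1–2: the Def. 1.7 ORIGIN PROFILE of `MuTwoSetting.modelχq` and its
# profinite `Π_C ⊇ Π_X ↠ G_K` (proof-only facets of row R244 «F4q-C»)

S. Mochizuki, *The étale theta function …*, Publ. RIMS **45** (2009) [EtTh], Def. 1.7 p. 27 («`ε_μ` … acts trivially on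
the set of irreducible components of the special fibre»), §2 p. 36 («`Π_X ⊆ Π_C`, `1 → Δ_X → Π_X → G_K → 1`»)
[cite: MochizukiEtTh2009, Def 1.7 p.27].

Cell abc-iut, layer L2, R78 cluster STAGE 2, seat abc-iut-w5-d249 (gen 5).  PROOF-ONLY (0 definitions), over this seat's
`SettingModelTateMuTwo(CLevel)` (`MuTwoSetting.modelχq`, `modelχq_cLevelData`), abc-iut-w5-d051's origin profile of the
stage-2 root (`SettingModelTateOrigin`: `not_isThm16Origin_modelχq`, `modelχq_isTateOrigin`) and abc-iut-L2-d3's generic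
`MuTwoSetting.CLevelData.piCData` — consumed BY NAME.

* **`epsMu_mem_sup_modelχq`** — the (P-C8) clause of `MuTwoSetting.IsDef17Origin` HOLDS at the stage-2 record:
  `ε_μ = inl b ∈ Π^tp_Ẍ · Π^tp_Y` (indeed `b ∈ Π^tp_Y = Ker toZ`, degree `0`);
* **`not_isDef17Origin_modelχq`** — yet `IsDef17Origin` FAILS at `(MuTwoSetting.modelχq p i 2 _)`, and ONLY through its
  `IsThm16Origin` component (the uncusped carrier `curveχq` has no closed point: abc-iut-w5-d051), `isDef17Origin_profile_modelχq`;
* **`nonempty_piCData_modelχq`** — `ThetaSetting.PiCData` (abc-iut-L2-t10's §2 datum: `Π_X ↪ Π_C` normal of index `2`,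
  `Π_C ↠ G_K` extending `augHat`) is INHABITED at the stage-2 root along the TEMPERED route: the profinite completion of
  `Π^tp_C = Π^tp_X ⋊_ι ℤ/2` chosen by abc-iut-L2-d3's `CLevelData.piCData` (companion of abc-iut-L2-t10's explicit
  `PiHtχq ⋊_σ̂ ℤ/2` construction at the cusped record, p439185).
SEMI-SYNTHETIC MODEL, CONSISTENCY EVIDENCE ONLY; nothing of [EtTh] asserted; no side taken on [IUTchIII] Cor. 3.12; typed ≠ proved.
-/

noncomputable section

namespace Literature.AnabelianGeometry.EtaleTheta.SettingModel

open Literature.AnabelianGeometry.SemiGraphs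
open Function

variable (p : ℕ) [Fact p.Prime] (i j : ℤ) (hj : Even j)

/-! ## §1. (P-C8): `ε_μ ∈ Π^tp_Ẍ · Π^tp_Y` -/

/-- `b ∈ Π^tp_Y = Ker(Π^tp_X ↠ Z)` at the stage-2 record (`b` has degree `0`). [cite: MochizukiEtTh2009, §1 p.12] -/
theorem inl_b_mem_GtpY_modelχq :
    (SemidirectProduct.inl (gfpOf (FreeGroup.of 1)) : PiTpχq p i j) ∈ (ThetaSetting.modelχq p i j hj).GtpY := by
  change (SemidirectProduct.inl (gfpOf (FreeGroup.of 1)) : PiTpχq p i j) ∈ (tateTwistData₀ p i j).toZ.ker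
  rw [MonoidHom.mem_ker, GfpTwistData₀.toZ_apply, SemidirectProduct.left_inl, gfpSnd_gfpOf, expA_apply, heisHom_of_one]
  rfl

/-- **(P-C8) of Def. 1.7 at the stage-2 record**: `ε_μ = inl b ∈ (Π^tp_Ẍ ⊔ Π^tp_Y).map inclX` («`ε_μ` acts trivially on
the irreducible components of the special fibre of `Ẍ`»). [cite: MochizukiEtTh2009, Def 1.7 p.27] -/
theorem epsMu_mem_sup_modelχq :
    (MuTwoSetting.modelχq p i j hj).epsMu ∈
      ((MuTwoSetting.modelχq p i j hj).GtpXdd ⊔ (MuTwoSetting.modelχq p i j hj).GtpY).map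
        (MuTwoSetting.modelχq p i j hj).inclX :=
  ⟨SemidirectProduct.inl (gfpOf (FreeGroup.of 1)), Subgroup.mem_sup_right (inl_b_mem_GtpY_modelχq p i j hj), rfl⟩

/-! ## §2. The Def. 1.7 origin profile at the Tate shear exponent `j = 2` -/

/-- **`IsDef17Origin` FAILS at the stage-2 record with `j = 2`** — only because its `IsThm16Origin` component fails at the
uncusped root `modelχq` (abc-iut-w5-d051's `not_isThm16Origin_modelχq`: `curveχq` has no closed point).
[cite: MochizukiEtTh2009, Def 1.7 p.27] -/
theorem not_isDef17Origin_modelχq : ¬ (MuTwoSetting.modelχq p i 2 even_two).IsDef17Origin := fun h =>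
  not_isThm16Origin_modelχq p i h.toIsThm16Origin

/-- **The Def. 1.7 origin profile of the stage-2 record** (`j = 2`): the §1 guard `IsEtThOrigin` ✓, the Tate-module clause
`IsTateOrigin` ✓ (abc-iut-w5-d051), `Compat` ✓, an admissible `ε_Z` ✓, C-level data ✓, (P-C8) `ε_μ ∈ Π^tp_Ẍ·Π^tp_Y` ✓ — and
`IsDef17Origin` ✗ through `IsThm16Origin` alone. [cite: MochizukiEtTh2009, Def 1.7 p.27] -/
theorem isDef17Origin_profile_modelχq :
    (MuTwoSetting.modelχq p i 2 even_two).toThetaSetting.IsEtThOrigin ∧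
      (MuTwoSetting.modelχq p i 2 even_two).toThetaSetting.IsTateOrigin ∧
      (MuTwoSetting.modelχq p i 2 even_two).toThetaSetting.Compat ∧
      (MuTwoSetting.modelχq p i 2 even_two).IsAdmissibleEpsZ (epsZCq p i 2) ∧
      Nonempty (MuTwoSetting.modelχq p i 2 even_two).CLevelData ∧
      (MuTwoSetting.modelχq p i 2 even_two).epsMu ∈
        ((MuTwoSetting.modelχq p i 2 even_two).GtpXdd ⊔ (MuTwoSetting.modelχq p i 2 even_two).GtpY).map
          (MuTwoSetting.modelχq p i 2 even_two).inclX ∧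
      ¬ (MuTwoSetting.modelχq p i 2 even_two).IsDef17Origin :=
  ⟨MuTwoSetting.modelχq_isEtThOrigin p i 2 even_two, modelχq_isTateOrigin p i, MuTwoSetting.modelχq_compat p i 2 even_two,
    MuTwoSetting.modelχq_isAdmissibleEpsZ p i 2 even_two, MuTwoSetting.nonempty_cLevelData_modelχq p i 2 even_two,
    epsMu_mem_sup_modelχq p i 2 even_two, not_isDef17Origin_modelχq p i⟩

/-! ## §3. The profinite `Π_C ⊇ Π_X ↠ G_K` of the stage-2 record (tempered route) -/

/-- **`ThetaSetting.PiCData` is inhabited at the stage-2 root `modelχq p i j hj`** along the tempered route: the profinite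
completion of `Π^tp_C = Π^tp_X ⋊_ι ℤ/2` chosen by abc-iut-L2-d3's `CLevelData.piCData` from this seat's C-level data.
[cite: MochizukiEtTh2009, Def 2.1 p.36] -/
theorem nonempty_piCData_modelχq :
    ∃ PC : ProfiniteGrp.{0}, Nonempty ((ThetaSetting.modelχq p i j hj).PiCData PC) :=
  ⟨(MuTwoSetting.modelχq_cLevelData p i j hj).PiCHat, ⟨(MuTwoSetting.modelχq_cLevelData p i j hj).piCData⟩⟩

/-- Its augmentation extends the model's `augC`: `aug (ι̂_C (inl x)) = aug x`. [cite: MochizukiEtTh2009, Def 2.1 p.36] -/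
theorem piCData_modelχq_aug_inclX (x : PiTpχq p i j) :
    (MuTwoSetting.modelχq_cLevelData p i j hj).piCData.aug
        ((MuTwoSetting.modelχq_cLevelData p i j hj).toPiCHat (SemidirectProduct.inl x)) = augχq p i j x := by
  rw [MuTwoSetting.CLevelData.piCData_aug_apply]
  exact augCq_inl p i j x

end Literature.AnabelianGeometry.EtaleTheta.SettingModel

end
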